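import Mathlib.Analysis.SpecialFunctions.Pow.Deriv
import Mathlib.Analysis.SpecialFunctions.Pow.Continuity
import Mathlib.Analysis.Calculus.Deriv.MeanValue
import Mathlib.Analysis.Calculus.Deriv.Slope
import Mathlib.Analysis.Calculus.Deriv.Star
import Mathlib.Analysis.Complex.RealDeriv
import Literature.Geometry.Lorentzian.KerrDeSitterMasterEquations
import HarnessLib

/-!
# The radial energy (boundary-flux) identity for scalar modes on subextremal Kerr–de Sitter
# (Casals–Teixeira da Costa 2022, proof of Theorem 3.10, Step 1; Dyatlov 2011, proof of Prop. 3.2(5))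

Theorems only (no named facts). For spin `s = 0` the radial master equation of
`KerrDeSitterMasterEquations.lean` (Casals–Teixeira da Costa (3.8) with the Klein–Gordon switch `μ`:
`μ = 0` the massless wave equation `□_g ψ = 0`, `μ = 1` the conformal scalar = the Teukolsky `s = 0`
equation of Suzuki–Takasugi–Umetsu / Hatsuda) is in Sturm–Liouville form on the exterior
`(r₊, r_c)`: `(Δ_r R')' + V R = 0`, `V = masterRadialPotential M a Λ 0 μ ω m λ̄`.

The printed argument is Casals–Teixeira da Costa, proof of Theorem 3.10, **Step 1**
[CasalsTeixeiradacosta2022, arXiv v3 p. 17] ("Suppose `s = 0` … we deduce the identities: if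
`Im ω > 0`, `0 ≥ Im ω ∫ (|u'|² + (((r²+a²)² − a²Δ)|ω|² − a²m²)/(r²+a²)² |u|²) dr*` … If
`Im ω > 0`, unless the superradiant condition `|ω|² < m²ϖ₁²` … holds, we may infer directly … that
`u ≡ 0`"), which is also Dyatlov's proof of [Dyatlov2011, Prop. 3.2 part 5] ("`Im V_x(x) =`
`−2(1+α)²((r²+a²)Re ω − ak)(r²+a²)Im ω + Im λ·Δ_r` … the sign of `Im V_x(x)` is constant in `x` …").
It is rendered here exactly as the angular Lemma 3.1 was rendered in
`KerrDeSitterPartialModeStability.lean`: in DIFFERENTIAL (boundary-flux) form, avoiding improper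
integrals. The flux `G(r) = Im(ω̄ · Δ_r(r) R'(r) conj R(r))` has `G' = −Δ_r|R'|² Im ω − |R|² Im(ω̄ V)`
(the ODE; `im_fluxDeriv_eq'`), the integrand is the pointwise identity
`Im(ω̄ V(r)) = Im ω · (Ξ²[((r²+a²)² − a²Δ_r)|ω|² − a²m²]/Δ_r + (2Λ/3)μr²) − Im(λ̄ ω̄)`
(`im_conj_mul_masterRadialPotential_zero`; in the `R`-variable there is no `(r²+a²)^{1/2}`
rescaling, so no extra potential term), and `G → 0` at both horizons because the generic
ingoing/outgoing branches have `|R|² ∼ (r − r₊)^{2β₊}`, `(r_c − r)^{2β_c}` with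
`β_h = Ξ(r_h²+a²) Im ω/|Δ_r'(r_h)| > 0` (`re_horizonB`, `tendsto_boundaryFlux_of_cpowBranch`; the
simple-zero signs `Δ_r'(r₊) > 0 > Δ_r'(r_c)` are DERIVED from the subextremal sign pattern,
`deltaDeriv_rPlus_pos`, `deltaDeriv_rCosmo_neg`). Results:

* `masterRadial_zero_eq_zero` — if `Im ω > 0`, `Im(λ̄ ω̄) ≤ 0`, `μ ≥ 0` and
  `a²m² < ((r²+a²)² − a²Δ_r(r))|ω|²` on `(r₊, r_c)` (not superradiant), an ingoing/outgoing `s = 0`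
  radial solution vanishes identically;
* `masterMode_zero_window` — a non-trivial one has `m ≠ 0` and `|ω| < |m|·ϖ₊`,
  `ϖ₊ = a/(r₊²+a²) = horizonAngVel a r₊` (uses `(r²+a²)² − a²Δ_r = (r²+a²)r²Ξ + 2Ma²r`, increasing,
  `= (r₊²+a²)²` at `r₊`: `sq_sub_sq_mul_delta`, `sq_lt_weight`);
* `masterRadial_zero_eq_zero_of_m_zero` — for `m = 0` there is none, any `μ ≥ 0`: the printed
  "mode stability for axially symmetric scalar perturbations holds true" [Hintz2021KdSModes, §1.3];
* `hasMode_zero_window`, `noModeIn_zero_superradiantComplement` — the conformal scalar (`μ = 1`,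
  i.e. the Teukolsky `s = 0` modes `HasMode M a Λ 0 ω m` of `KerrDeSitterTeukolskyRadial.lean`):
  growing modes are superradiant, `m ≠ 0` and `|ω| < |m|ϖ₊`, with the angular sign taken from the
  named fact `CasalsTeixeiraDaCosta2022_angularSign` (Lemma 3.1 (3.7)), which is PROVED in
  `KerrDeSitterPartialModeStability.lean` — instantiate `h2 := CasalsTeixeiraDaCosta2022_angularSign_holds`;
* `noMasterModeIn_zero_superradiantComplement` — the same for any `μ ≥ 0` (e.g. `μ = 0`, `□_g`),
  conditional on the `μ`-angular sign `Im(λ̄ ω̄) ≤ 0` (hypothesis `hsign`);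
* `hasMode_zero_window'`, `noModeIn_zero_superradiantComplement'`, `masterMode_zero_window'`,
  `not_hasMasterMode_zero_of_m_zero`, `noMasterModeIn_zero_superradiantComplement'` — the same
  statements with the angular sign DISCHARGED by the proved Lemma 3.1
  (`CasalsTeixeiraDaCosta2022_angularSign_holds`, `masterAngularEigenvalue_sign` of
  `KerrDeSitterMasterEquations.lean`): unconditional for every subextremal `(M, a, Λ)` with `a > 0`.

This is Step 1 only: the sharper window `|ω| < |m| Ω_SR` of Theorem 3.10 (hidden-symmetry Steps 2–3)
and all `s ≠ 0` statements remain the named fact `CasalsTeixeiraDaCosta2022_partialModeStability`.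
-/


noncomputable section

open Complex Set Filter Topology

open scoped ComplexConjugate

namespace Literature.Geometry.Lorentzian.KerrDeSitter

/-! ### One-dimensional skeleton and the boundary flux of a complex-exponent branch -/

/-- A real function on `(lo, hi)` with non-positive derivative, negative somewhere, cannot tend to `0`
at both endpoints (the skeleton of the printed positivity argument; `false_of_antitone_flux` of
`KerrDeSitterPartialModeStability.lean` on a general interval).
[cite: CasalsTeixeiradacosta2022, Theorem 3.10 (proof, Step 1)] -/
theorem false_of_antitone_flux_Ioo {lo hi : ℝ} {G G' : ℝ → ℝ}
    (hderiv : ∀ x ∈ Ioo lo hi, HasDerivAt G (G' x) x) (hnonpos : ∀ x ∈ Ioo lo hi, G' x ≤ 0)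
    (hneg : ∃ x ∈ Ioo lo hi, G' x < 0) (hleft : Tendsto G (𝓝[>] lo) (𝓝 0))
    (hright : Tendsto G (𝓝[<] hi) (𝓝 0)) : False := by
  have hDo : IsOpen (Ioo lo hi) := isOpen_Ioo
  have hint : interior (Ioo lo hi) = Ioo lo hi := hDo.interior_eq
  have hcont : ContinuousOn G (Ioo lo hi) := fun x hx =>
    (hderiv x hx).continuousAt.continuousWithinAt
  have hanti : AntitoneOn G (Ioo lo hi) := by
    apply antitoneOn_of_hasDerivWithinAt_nonpos (convex_Ioo _ _) hcont
    · intro x hx; rw [hint] at hx ⊢; exact (hderiv x hx).hasDerivWithinAt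
    · intro x hx; rw [hint] at hx; exact hnonpos x hx
  have hle : ∀ x ∈ Ioo lo hi, G x ≤ 0 := by
    intro x hx
    have hev : ∀ᶠ y in 𝓝[>] lo, G x ≤ G y := by
      filter_upwards [Ioo_mem_nhdsGT hx.1] with y hy
      exact hanti ⟨hy.1, hy.2.trans hx.2⟩ hx hy.2.le
    exact ge_of_tendsto hleft hev
  have hge : ∀ x ∈ Ioo lo hi, 0 ≤ G x := by
    intro x hx
    have hev : ∀ᶠ y in 𝓝[<] hi, G y ≤ G x := by
      filter_upwards [Ioo_mem_nhdsLT hx.2] with y hy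
      exact hanti hx ⟨hx.1.trans hy.1, hy.2⟩ hy.1.le
    exact le_of_tendsto hright hev
  obtain ⟨x₀, hx₀, hneg₀⟩ := hneg
  have hzero : G =ᶠ[𝓝 x₀] fun _ => (0 : ℝ) := by
    filter_upwards [hDo.mem_nhds hx₀] with y hy
    exact le_antisymm (hle y hy) (hge y hy)
  have h0 : HasDerivAt G 0 x₀ := (hasDerivAt_const x₀ (0 : ℝ)).congr_of_eventuallyEq hzero
  have := (hderiv x₀ hx₀).unique h0
  linarith

/-- Boundary behaviour of a branch with COMPLEX exponent. If on an open set `J` (one side of `x₀`)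
`S = u^z · g` with `u` affine (`u' ≡ c`), `u > 0` on `J`, `u(x₀) = 0`, `Re z > 0`, `g` smooth on an
open `U ⊇ J` containing `x₀`, and `S` is differentiable on `J` with derivative `S'`, then the flux
density `u · S' · conj S` tends to `0` as `x → x₀` within `J` (it equals
`u^{2 Re z}(c z |g|² + u g' ḡ)` on `J`). This is the vanishing of the horizon boundary terms of the
printed energy identity for `Im ω > 0` (`|u|² ∼ (r − r_h)^{Im ω/κ_h}`).
[cite: CasalsTeixeiradacosta2022, Theorem 3.10 (proof, Step 1)] -/
theorem tendsto_boundaryFlux_of_cpowBranch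
    {U J : Set ℝ} {x₀ : ℝ} (hU : IsOpen U) (hx₀ : x₀ ∈ U) (hJ : IsOpen J) (hJU : J ⊆ U)
    {g : ℝ → ℂ} (hg : ContDiffOn ℝ ((⊤ : ℕ∞) : WithTop ℕ∞) g U)
    {u : ℝ → ℝ} {c : ℝ} (hu : ∀ x, HasDerivAt u c x) (hu0 : u x₀ = 0) (hupos : ∀ x ∈ J, 0 < u x)
    {z : ℂ} (hz : 0 < z.re) {S S' : ℝ → ℂ} (hS : ∀ x ∈ J, HasDerivAt S (S' x) x)
    (hSg : ∀ x ∈ J, S x = ((u x : ℝ) : ℂ) ^ z * g x) :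
    Tendsto (fun x => ((u x : ℝ) : ℂ) * S' x * conj (S x)) (𝓝[J] x₀) (𝓝 0) := by
  have h1 : (1 : WithTop ℕ∞) ≤ ((⊤ : ℕ∞) : WithTop ℕ∞) := by exact_mod_cast le_top
  have h0 : ((⊤ : ℕ∞) : WithTop ℕ∞) ≠ 0 := by simp
  have hgd : DifferentiableOn ℝ g U := hg.differentiableOn h0
  have hgc : ContinuousAt g x₀ :=
    (hgd.continuousOn.continuousWithinAt hx₀).continuousAt (hU.mem_nhds hx₀)
  have hg'c : ContinuousAt (deriv g) x₀ :=
    ((hg.continuousOn_deriv_of_isOpen hU h1).continuousWithinAt hx₀).continuousAt (hU.mem_nhds hx₀)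
  -- the derivative of `S` on `J`, from the branch representation
  have hS' : ∀ x ∈ J, S' x = z * ((u x : ℝ) : ℂ) ^ (z - 1) * (c : ℂ) * g x +
      ((u x : ℝ) : ℂ) ^ z * deriv g x := by
    intro x hx
    have hgx : HasDerivAt g (deriv g x) x :=
      ((hgd x (hJU hx)).differentiableAt (hU.mem_nhds (hJU hx))).hasDerivAt
    have hux : HasDerivAt (fun y => ((u y : ℝ) : ℂ)) (c : ℂ) x := (hu x).ofReal_comp
    have hslit : ((u x : ℝ) : ℂ) ∈ slitPlane := Complex.ofReal_mem_slitPlane.2 (hupos x hx)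
    have hpow' : HasDerivAt ((fun w : ℂ => w ^ z) ∘ fun y => ((u y : ℝ) : ℂ))
        (z * ((u x : ℝ) : ℂ) ^ (z - 1) * (c : ℂ)) x :=
      (Complex.hasStrictDerivAt_cpow_const (c := z) hslit).hasDerivAt.comp x hux
    have hpow : HasDerivAt (fun y => ((u y : ℝ) : ℂ) ^ z)
        (z * ((u x : ℝ) : ℂ) ^ (z - 1) * (c : ℂ)) x := by
      simpa only [Function.comp_def] using hpow'
    have hprod := hpow.mul hgx
    have heq : S =ᶠ[𝓝 x] fun y => ((u y : ℝ) : ℂ) ^ z * g y :=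
      Filter.eventually_of_mem (hJ.mem_nhds hx) fun y hy => hSg y hy
    exact (hS x hx).unique (hprod.congr_of_eventuallyEq heq)
  -- the flux density on `J`
  have hflux : ∀ x ∈ J, ((u x : ℝ) : ℂ) * S' x * conj (S x) =
      ((((u x) ^ z.re) ^ 2 : ℝ) : ℂ) *
        (z * (c : ℂ) * (g x * conj (g x)) + ((u x : ℝ) : ℂ) * (deriv g x * conj (g x))) := by
    intro x hx
    have hU0 : 0 < u x := hupos x hx
    have hne : ((u x : ℝ) : ℂ) ≠ 0 := by exact_mod_cast hU0.ne'
    have e1 : ((u x : ℝ) : ℂ) * ((u x : ℝ) : ℂ) ^ (z - 1) = ((u x : ℝ) : ℂ) ^ z := by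
      rw [cpow_sub _ _ hne, cpow_one]
      field_simp
    have e2 : ((u x : ℝ) : ℂ) ^ z * conj (((u x : ℝ) : ℂ) ^ z) = ((((u x) ^ z.re) ^ 2 : ℝ) : ℂ) := by
      rw [Complex.mul_conj, Complex.normSq_eq_norm_sq, Complex.norm_cpow_eq_rpow_re_of_pos hU0]
    have hS'' : ((u x : ℝ) : ℂ) * S' x =
        ((u x : ℝ) : ℂ) ^ z * (z * (c : ℂ) * g x + ((u x : ℝ) : ℂ) * deriv g x) := by
      rw [hS' x hx, ← e1]
      ring
    calc ((u x : ℝ) : ℂ) * S' x * conj (S x)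
        = (((u x : ℝ) : ℂ) * S' x) * conj (S x) := by ring
      _ = (((u x : ℝ) : ℂ) ^ z * (z * (c : ℂ) * g x + ((u x : ℝ) : ℂ) * deriv g x)) *
            (conj (((u x : ℝ) : ℂ) ^ z) * conj (g x)) := by rw [hS'', hSg x hx, map_mul]
      _ = (((u x : ℝ) : ℂ) ^ z * conj (((u x : ℝ) : ℂ) ^ z)) *
            (z * (c : ℂ) * (g x * conj (g x)) + ((u x : ℝ) : ℂ) * (deriv g x * conj (g x))) := by
          ring
      _ = ((((u x) ^ z.re) ^ 2 : ℝ) : ℂ) *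
            (z * (c : ℂ) * (g x * conj (g x)) + ((u x : ℝ) : ℂ) * (deriv g x * conj (g x))) := by
          rw [e2]
  -- the model expression tends to `0`
  have hu_t : Tendsto u (𝓝 x₀) (𝓝 0) := by
    simpa [hu0] using (hu x₀).continuousAt.tendsto
  have t1 : Tendsto (fun x => ((u x) ^ z.re) ^ 2) (𝓝 x₀) (𝓝 0) := by
    simpa using (hu_t.rpow_const_nhds_zero hz).pow 2
  have t3 : Tendsto g (𝓝 x₀) (𝓝 (g x₀)) := hgc.tendsto
  have t3c : Tendsto (fun x => conj (g x)) (𝓝 x₀) (𝓝 (conj (g x₀))) :=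
    (Complex.continuous_conj.tendsto _).comp t3
  have t4 : Tendsto (deriv g) (𝓝 x₀) (𝓝 (deriv g x₀)) := hg'c.tendsto
  have hb : Tendsto (fun x => z * (c : ℂ) * (g x * conj (g x)) +
      ((u x : ℝ) : ℂ) * (deriv g x * conj (g x))) (𝓝 x₀)
      (𝓝 (z * (c : ℂ) * (g x₀ * conj (g x₀)) + ((0 : ℝ) : ℂ) * (deriv g x₀ * conj (g x₀)))) :=
    ((t3.mul t3c).const_mul _).add (hu_t.ofReal.mul (t4.mul t3c))
  have tM : Tendsto (fun x => ((((u x) ^ z.re) ^ 2 : ℝ) : ℂ) *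
      (z * (c : ℂ) * (g x * conj (g x)) + ((u x : ℝ) : ℂ) * (deriv g x * conj (g x)))) (𝓝 x₀) (𝓝 0) := by
    have := t1.ofReal.mul hb
    simpa only [Complex.ofReal_zero, zero_mul] using this
  refine (tM.mono_left nhdsWithin_le_nhds).congr' ?_
  filter_upwards [self_mem_nhdsWithin] with x hx
  exact (hflux x hx).symm

/-- Imaginary part of the derivative of the flux `conj c · (P|R'|² − V|R|²)` (pure algebra).
[cite: CasalsTeixeiradacosta2022, Theorem 3.10 (proof, Step 1)] -/
theorem im_fluxDeriv_eq' (c v z z' : ℂ) (P : ℝ) :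
    (conj c * ((P : ℂ) * (z' * conj z') - v * (z * conj z))).im =
      -(P * normSq z' * c.im) - normSq z * (conj c * v).im := by
  rw [Complex.mul_conj, Complex.mul_conj]
  simp only [mul_im, mul_re, sub_im, sub_re, ofReal_re, ofReal_im, conj_re, conj_im]
  ring

/-! ### Algebra of the `s = 0` radial coefficient -/

/-- `(r² + a²)² − a²Δ_r = (r² + a²) r² Ξ + 2Ma²r` (so it is positive and increasing on `r > 0`).
[cite: CasalsTeixeiradacosta2022, Theorem 3.10 (proof, Step 1)] -/
theorem sq_sub_sq_mul_delta (M a Λ r : ℝ) :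
    (r ^ 2 + a ^ 2) ^ 2 - a ^ 2 * delta M a Λ r = (r ^ 2 + a ^ 2) * r ^ 2 * xi a Λ + 2 * M * a ^ 2 * r := by
  unfold delta xi
  ring

/-- Monotonicity: for `0 < M`, `0 ≤ Λ` and `0 < r₁ < r`,
`(r₁²+a²)r₁²Ξ + 2Ma²r₁ < (r²+a²)r²Ξ + 2Ma²r`. [cite: CasalsTeixeiradacosta2022, Theorem 3.10 (proof, Step 1)] -/
theorem weight_strictMono {M a Λ r₁ r : ℝ} (hM : 0 < M) (hΛ : 0 ≤ Λ) (hr₁ : 0 < r₁) (hr : r₁ < r) :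
    (r₁ ^ 2 + a ^ 2) * r₁ ^ 2 * xi a Λ + 2 * M * a ^ 2 * r₁ <
      (r ^ 2 + a ^ 2) * r ^ 2 * xi a Λ + 2 * M * a ^ 2 * r := by
  have hξ : 0 < xi a Λ := xi_pos hΛ a
  have h1 : r₁ ^ 2 < r ^ 2 := by nlinarith
  have h2 : (r₁ ^ 2 + a ^ 2) * r₁ ^ 2 < (r ^ 2 + a ^ 2) * r ^ 2 := by nlinarith [sq_nonneg a]
  have h3 : 2 * M * a ^ 2 * r₁ ≤ 2 * M * a ^ 2 * r :=
    mul_le_mul_of_nonneg_left hr.le (by positivity)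
  nlinarith

/-- The `s = 0` master radial coefficient is a quadratic in `ω` with REAL coefficients, minus `λ̄`:
`V = A ω² + B ω + C − λ̄` with `A = Ξ²((r²+a²)² − a²Δ_r)/Δ_r`, `B = 2Ξ²am(Δ_r − (r²+a²))/Δ_r`,
`C = Ξ²a²m²/Δ_r − (2Λ/3)μr²`. [cite: CasalsTeixeiradacosta2022, (3.8)] -/
theorem masterRadialPotential_zero_eq (M a Λ μ : ℝ) (ω : ℂ) (m : ℝ) (lamBar : ℂ) {r : ℝ}
    (hΔ : delta M a Λ r ≠ 0) :
    masterRadialPotential M a Λ 0 μ ω m lamBar r =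
      ((xi a Λ ^ 2 * ((r ^ 2 + a ^ 2) ^ 2 - a ^ 2 * delta M a Λ r) / delta M a Λ r : ℝ) : ℂ) * ω ^ 2 +
        ((2 * xi a Λ ^ 2 * a * m * (delta M a Λ r - (r ^ 2 + a ^ 2)) / delta M a Λ r : ℝ) : ℂ) * ω +
        ((xi a Λ ^ 2 * a ^ 2 * m ^ 2 / delta M a Λ r - 2 * (Λ / 3) * μ * r ^ 2 : ℝ) : ℂ) - lamBar := by
  have hΔ' : (delta M a Λ r : ℂ) ≠ 0 := by exact_mod_cast hΔ
  simp only [masterRadialPotential, radialK]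
  push_cast
  field_simp
  ring

/-- `Im(c̄ (A c² + B c + C − λ̄)) = Im c · (A|c|² − C) − Im(λ̄ c̄)` for real `A, B, C` (pure algebra).
[cite: CasalsTeixeiradacosta2022, Theorem 3.10 (proof, Step 1)] -/
theorem im_conj_mul_quadratic' (c lamBar : ℂ) (A B C : ℝ) :
    (conj c * ((A : ℂ) * c ^ 2 + (B : ℂ) * c + (C : ℂ) - lamBar)).im =
      c.im * (A * normSq c - C) - (lamBar * conj c).im := by
  simp only [pow_two, mul_im, mul_re, add_im, add_re, sub_im, sub_re, ofReal_re, ofReal_im,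
    conj_re, conj_im, normSq_apply]
  ring

/-- **The integrand of the printed identity, pointwise** (`s = 0`): for `Δ_r(r) ≠ 0`,
`Im(ω̄ V(r)) = Im ω · (Ξ²[((r²+a²)² − a²Δ_r)|ω|² − a²m²]/Δ_r + (2Λ/3)μr²) − Im(λ̄ ω̄)`.
[cite: CasalsTeixeiradacosta2022, Theorem 3.10 (proof, Step 1)] -/
theorem im_conj_mul_masterRadialPotential_zero (M a Λ μ : ℝ) (ω : ℂ) (m : ℝ) (lamBar : ℂ) {r : ℝ}
    (hΔ : delta M a Λ r ≠ 0) :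
    (conj ω * masterRadialPotential M a Λ 0 μ ω m lamBar r).im =
      ω.im * (xi a Λ ^ 2 * (((r ^ 2 + a ^ 2) ^ 2 - a ^ 2 * delta M a Λ r) * normSq ω - a ^ 2 * m ^ 2) /
          delta M a Λ r + 2 * (Λ / 3) * μ * r ^ 2) - (lamBar * conj ω).im := by
  rw [masterRadialPotential_zero_eq M a Λ μ ω m lamBar hΔ, im_conj_mul_quadratic']
  congr 1
  field_simp
  ring

/-- Real part of the horizon exponent: `Re B(r_h) = −Ξ(r_h² + a²) Im ω / Δ_r'(r_h)`.
[cite: Hatsuda2020, (2.18)] -/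
theorem re_horizonB (M a Λ : ℝ) (ω : ℂ) (m : ℝ) (rh : ℝ) :
    (horizonB M a Λ ω m rh).re = -(xi a Λ * (rh ^ 2 + a ^ 2) * ω.im) / deltaDeriv M a Λ rh := by
  simp only [horizonB, radialK]
  rw [Complex.div_ofReal_re]
  simp only [mul_re, mul_im, sub_re, sub_im, I_re, I_im, ofReal_re, ofReal_im]
  ring

/-! ### Simple zeros of `Δ_r` at the horizons (from the subextremal sign pattern) -/

/-- Exact Taylor expansion of the quartic `Δ_r` at a point `p` (pure algebra).
[cite: Hatsuda2020, (2.13)] -/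
theorem delta_taylor (M a Λ p x : ℝ) :
    delta M a Λ x = delta M a Λ p + deltaDeriv M a Λ p * (x - p) +
      (x - p) ^ 2 * ((1 - Λ / 3 * a ^ 2 - 2 * Λ * p ^ 2) - 4 * Λ / 3 * p * (x - p) -
        Λ / 3 * (x - p) ^ 2) := by
  unfold delta deltaDeriv
  ring

/-- A zero `p > 0` of `Δ_r` at which `Δ_r` changes sign strictly, in the presence of a second positive
zero `q ≠ p`, is simple (`Λ > 0`): if `Δ_r'(p) = 0` the exact Taylor expansion makes `Δ_r` keep the
sign of its quadratic coefficient on both sides of `p`, and if that coefficient vanishes too then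
`Δ_r(x) = −(Λ/3)(x − p)³(x + 3p)` has no positive zero other than `p`.
[cite: PetersenVasy2021, (1.2)–(1.3)] -/
theorem deltaDeriv_ne_zero_of_signChange {M a Λ p q lo hi : ℝ} (hΛ : 0 < Λ) (hp : 0 < p)
    (hq : 0 < q) (hpq : q ≠ p) (hΔp : delta M a Λ p = 0) (hΔq : delta M a Λ q = 0)
    (hlo : lo < p) (hhi : p < hi)
    (hsign : ((∀ x ∈ Ioo lo p, delta M a Λ x < 0) ∧ ∀ x ∈ Ioo p hi, 0 < delta M a Λ x) ∨
      ((∀ x ∈ Ioo lo p, 0 < delta M a Λ x) ∧ ∀ x ∈ Ioo p hi, delta M a Λ x < 0)) :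
    deltaDeriv M a Λ p ≠ 0 := by
  intro hD
  -- with `Δ(p) = Δ'(p) = 0`: `Δ(x) = (x − p)² Q(x)`
  set c₂ : ℝ := 1 - Λ / 3 * a ^ 2 - 2 * Λ * p ^ 2 with hc₂
  have hΔ : ∀ x, delta M a Λ x =
      (x - p) ^ 2 * (c₂ - 4 * Λ / 3 * p * (x - p) - Λ / 3 * (x - p) ^ 2) := by
    intro x
    rw [delta_taylor M a Λ p x, hΔp, hD]
    ring
  have hQc : Continuous fun x : ℝ => c₂ - 4 * Λ / 3 * p * (x - p) - Λ / 3 * (x - p) ^ 2 := by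
    fun_prop
  have hQt : Tendsto (fun x : ℝ => c₂ - 4 * Λ / 3 * p * (x - p) - Λ / 3 * (x - p) ^ 2) (𝓝 p)
      (𝓝 c₂) := by
    have := hQc.tendsto p
    simpa using this
  rcases lt_trichotomy c₂ 0 with hneg | hzero | hpos
  · -- `Q(p) < 0`: `Δ < 0` on both sides of `p` near `p`
    have hev : ∀ᶠ x in 𝓝 p, c₂ - 4 * Λ / 3 * p * (x - p) - Λ / 3 * (x - p) ^ 2 < 0 :=
      hQt.eventually_lt tendsto_const_nhds hneg
    rcases hsign with ⟨-, hpos'⟩ | ⟨hpos', -⟩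
    · obtain ⟨x, hQx, hx⟩ := ((hev.filter_mono nhdsWithin_le_nhds).and (Ioo_mem_nhdsGT hhi)).exists
      have h := hpos' x hx
      rw [hΔ x] at h
      have hsq : 0 ≤ (x - p) ^ 2 := sq_nonneg _
      nlinarith
    · obtain ⟨x, hQx, hx⟩ := ((hev.filter_mono nhdsWithin_le_nhds).and (Ioo_mem_nhdsLT hlo)).exists
      have h := hpos' x hx
      rw [hΔ x] at h
      have hsq : 0 ≤ (x - p) ^ 2 := sq_nonneg _
      nlinarith
  · -- `Q(p) = 0`: then `Δ(q) = −(Λ/3)(q − p)³(3p + q) ≠ 0`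
    have e := hΔ q
    rw [hΔq, hzero] at e
    have e2 : (q - p) ^ 3 * (Λ * (3 * p + q)) = 0 := by linear_combination (3 : ℝ) * e
    rcases mul_eq_zero.1 e2 with h3 | h3
    · exact hpq (sub_eq_zero.1 (pow_eq_zero_iff (by norm_num) |>.1 h3))
    · have : 0 < Λ * (3 * p + q) := by positivity
      linarith
  · -- `Q(p) > 0`: `Δ > 0` on both sides of `p` near `p`
    have hev : ∀ᶠ x in 𝓝 p, 0 < c₂ - 4 * Λ / 3 * p * (x - p) - Λ / 3 * (x - p) ^ 2 :=
      tendsto_const_nhds.eventually_lt hQt hpos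
    rcases hsign with ⟨hneg', -⟩ | ⟨-, hneg'⟩
    · obtain ⟨x, hQx, hx⟩ := ((hev.filter_mono nhdsWithin_le_nhds).and (Ioo_mem_nhdsLT hlo)).exists
      have h := hneg' x hx
      rw [hΔ x] at h
      have hsq : 0 ≤ (x - p) ^ 2 := sq_nonneg _
      nlinarith
    · obtain ⟨x, hQx, hx⟩ := ((hev.filter_mono nhdsWithin_le_nhds).and (Ioo_mem_nhdsGT hhi)).exists
      have h := hneg' x hx
      rw [hΔ x] at h
      have hsq : 0 ≤ (x - p) ^ 2 := sq_nonneg _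
      nlinarith

/-- The Cauchy-horizon radius is non-negative (an infimum of positive reals). [cite: PetersenVasy2021, (1.2)–(1.3)] -/
theorem rMinus_nonneg (M a Λ : ℝ) : 0 ≤ rMinus M a Λ := by
  unfold rMinus
  exact Real.sInf_nonneg (fun x hx => le_of_lt hx.1)

/-- On subextremal Kerr–de Sitter the event horizon is a simple zero of `Δ_r` with `Δ_r'(r₊) > 0`.
[cite: PetersenVasy2021, (1.2)–(1.3)] -/
theorem deltaDeriv_rPlus_pos {M a Λ : ℝ} (hsub : IsSubextremal M a Λ) :
    0 < deltaDeriv M a Λ (rPlus M a Λ) := by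
  obtain ⟨hM, hΛ, h01, h12, hΔ1, hΔ2, hneg, hpos, -⟩ := hsub
  have hr₁ : 0 < rPlus M a Λ := lt_of_le_of_lt (rMinus_nonneg M a Λ) h01
  have hr₂ : 0 < rCosmo M a Λ := hr₁.trans h12
  have hne : deltaDeriv M a Λ (rPlus M a Λ) ≠ 0 :=
    deltaDeriv_ne_zero_of_signChange hΛ hr₁ hr₂ (ne_of_gt h12) hΔ1 hΔ2 h01 h12 (Or.inl ⟨hneg, hpos⟩)
  have hge : 0 ≤ deltaDeriv M a Λ (rPlus M a Λ) := by
    have ht : Tendsto (slope (delta M a Λ) (rPlus M a Λ)) (𝓝[>] rPlus M a Λ)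
        (𝓝 (deltaDeriv M a Λ (rPlus M a Λ))) :=
      ((hasDerivAt_iff_tendsto_slope).1 (hasDerivAt_delta M a Λ (rPlus M a Λ))).mono_left
        (nhdsWithin_mono _ fun x hx => ne_of_gt hx)
    refine ge_of_tendsto ht ?_
    filter_upwards [Ioo_mem_nhdsGT h12] with x hx
    rw [slope_def_field, hΔ1, sub_zero]
    exact (div_pos (hpos x hx) (by linarith [hx.1])).le
  exact lt_of_le_of_ne hge hne.symm

/-- On subextremal Kerr–de Sitter the cosmological horizon is a simple zero of `Δ_r` with
`Δ_r'(r_c) < 0`. [cite: PetersenVasy2021, (1.2)–(1.3)] -/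
theorem deltaDeriv_rCosmo_neg {M a Λ : ℝ} (hsub : IsSubextremal M a Λ) :
    deltaDeriv M a Λ (rCosmo M a Λ) < 0 := by
  obtain ⟨hM, hΛ, h01, h12, hΔ1, hΔ2, -, hpos, hout⟩ := hsub
  have hr₁ : 0 < rPlus M a Λ := lt_of_le_of_lt (rMinus_nonneg M a Λ) h01
  have hr₂ : 0 < rCosmo M a Λ := hr₁.trans h12
  have hne : deltaDeriv M a Λ (rCosmo M a Λ) ≠ 0 :=
    deltaDeriv_ne_zero_of_signChange (hi := rCosmo M a Λ + 1) hΛ hr₂ hr₁ (ne_of_lt h12) hΔ2 hΔ1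
      h12 (by linarith) (Or.inr ⟨hpos, fun x hx => hout x hx.1⟩)
  have hle : deltaDeriv M a Λ (rCosmo M a Λ) ≤ 0 := by
    have ht : Tendsto (slope (delta M a Λ) (rCosmo M a Λ)) (𝓝[<] rCosmo M a Λ)
        (𝓝 (deltaDeriv M a Λ (rCosmo M a Λ))) :=
      ((hasDerivAt_iff_tendsto_slope).1 (hasDerivAt_delta M a Λ (rCosmo M a Λ))).mono_left
        (nhdsWithin_mono _ fun x hx => ne_of_lt hx)
    refine le_of_tendsto ht ?_
    filter_upwards [Ioo_mem_nhdsLT h12] with x hx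
    rw [slope_def_field, hΔ2, sub_zero]
    exact (div_neg_of_pos_of_neg (hpos x hx) (by linarith [hx.2])).le
  exact lt_of_le_of_ne hle hne

/-! ### The energy identity: non-superradiant growing scalar modes do not exist -/

/-- **Casals–Teixeira da Costa 2022, proof of Theorem 3.10, Step 1 (`s = 0`), in boundary-flux form.**
On subextremal Kerr–de Sitter, let `R` solve the `s = 0` radial master equation with Klein–Gordon
switch `μ ≥ 0`, frequency `Im ω > 0`, separation constant `λ̄` with `Im(λ̄ ω̄) ≤ 0` (Lemma 3.1), ingoing
at `𝓗⁺` and outgoing at `𝓗⁺_c` (generic exponents). If the frequency is NOT superradiant in the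
sense `a²m² < ((r²+a²)² − a²Δ_r(r))|ω|²` for every `r ∈ (r₊, r_c)`, then `R ≡ 0` on `(r₊, r_c)`
("unless the superradiant condition … holds, we may infer directly … that `u ≡ 0`").
[cite: CasalsTeixeiradacosta2022, Theorem 3.10 (proof, Step 1)] -/
theorem masterRadial_zero_eq_zero {M a Λ μ : ℝ} {ω : ℂ} {m : ℝ} {lamBar : ℂ}
    (hsub : IsSubextremal M a Λ) (hμ : 0 ≤ μ)
    (hω : 0 < ω.im) (hlam : (lamBar * conj ω).im ≤ 0)
    (hW : ∀ r ∈ Ioo (rPlus M a Λ) (rCosmo M a Λ),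
      a ^ 2 * m ^ 2 < ((r ^ 2 + a ^ 2) ^ 2 - a ^ 2 * delta M a Λ r) * normSq ω)
    {R : ℝ → ℂ} (hR : IsMasterRadialSolution M a Λ 0 μ ω m lamBar R)
    (hin : IsIngoingAtEventHorizon M a Λ 0 ω m R) (hout : IsOutgoingAtCosmoHorizon M a Λ ω m R) :
    ∀ r ∈ Ioo (rPlus M a Λ) (rCosmo M a Λ), R r = 0 := by
  have hd1 := deltaDeriv_rPlus_pos hsub
  have hd2 := deltaDeriv_rCosmo_neg hsub
  obtain ⟨hM, hΛ, h01, h12, hΔ1, hΔ2, -, hΔpos, -⟩ := hsub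
  by_contra hcon
  push Not at hcon
  obtain ⟨r₀, hr₀, hR₀⟩ := hcon
  obtain ⟨R', R'', hode⟩ := hR
  have hξ : 0 < xi a Λ := xi_pos hΛ.le a
  have hrm : 0 ≤ rMinus M a Λ := by
    unfold rMinus
    exact Real.sInf_nonneg (fun x hx => le_of_lt hx.1)
  have hr₁ : 0 < rPlus M a Λ := lt_of_le_of_lt hrm h01
  have hr₂ : 0 < rCosmo M a Λ := hr₁.trans h12
  -- the pointwise sign of `Im(ω̄ V)` on `(r₊, r_c)`
  have hVpos : ∀ r ∈ Ioo (rPlus M a Λ) (rCosmo M a Λ),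
      0 < (conj ω * masterRadialPotential M a Λ 0 μ ω m lamBar r).im := by
    intro r hr
    have hΔ : 0 < delta M a Λ r := hΔpos r hr
    rw [im_conj_mul_masterRadialPotential_zero M a Λ μ ω m lamBar hΔ.ne']
    have h1 : 0 < xi a Λ ^ 2 * (((r ^ 2 + a ^ 2) ^ 2 - a ^ 2 * delta M a Λ r) * normSq ω -
        a ^ 2 * m ^ 2) / delta M a Λ r :=
      div_pos (mul_pos (pow_pos hξ 2) (sub_pos.2 (hW r hr))) hΔ
    have h2 : 0 ≤ 2 * (Λ / 3) * μ * r ^ 2 := by positivity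
    have h3 := mul_pos hω (add_pos_of_pos_of_nonneg h1 h2)
    linarith
  refine false_of_antitone_flux_Ioo (lo := rPlus M a Λ) (hi := rCosmo M a Λ)
    (G := fun r => (conj ω * ((delta M a Λ r : ℂ) * R' r * conj (R r))).im)
    (G' := fun r => (conj ω * ((delta M a Λ r : ℂ) * (R' r * conj (R' r)) -
        masterRadialPotential M a Λ 0 μ ω m lamBar r * (R r * conj (R r)))).im) ?_ ?_ ?_ ?_ ?_
  · -- `G` is differentiable with derivative `G'` (the ODE enters here)
    intro r hr
    obtain ⟨h1, h2, heq⟩ := hode r hr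
    have hΔd : HasDerivAt (fun y => (delta M a Λ y : ℂ)) ((deltaDeriv M a Λ r : ℝ) : ℂ) r :=
      (hasDerivAt_delta M a Λ r).ofReal_comp
    have hRbar : HasDerivAt (fun y => conj (R y)) (conj (R' r)) r := by simpa using h1.star
    have hprod := ((hΔd.fun_mul h2).fun_mul hRbar).const_mul (conj ω)
    have heq' : (delta M a Λ r : ℂ) * R'' r + (deltaDeriv M a Λ r : ℂ) * R' r =
        -(masterRadialPotential M a Λ 0 μ ω m lamBar r * R r) := by
      have h := heq
      simp only [zero_add, ofReal_one, one_mul] at h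
      linear_combination h
    have hF : HasDerivAt (fun y => conj ω * ((delta M a Λ y : ℂ) * R' y * conj (R y)))
        (conj ω * ((delta M a Λ r : ℂ) * (R' r * conj (R' r)) -
          masterRadialPotential M a Λ 0 μ ω m lamBar r * (R r * conj (R r)))) r := by
      refine hprod.congr_deriv ?_
      linear_combination (conj ω * conj (R r)) * heq'
    simpa only [Function.comp_def, Complex.imCLM_apply] using
      (Complex.imCLM.hasFDerivAt.comp_hasDerivAt r hF)
  · -- `G' ≤ 0`
    intro r hr
    have hΔ : 0 < delta M a Λ r := hΔpos r hr
    show (conj ω * ((delta M a Λ r : ℂ) * (R' r * conj (R' r)) -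
        masterRadialPotential M a Λ 0 μ ω m lamBar r * (R r * conj (R r)))).im ≤ 0
    rw [im_fluxDeriv_eq']
    have t1 := mul_nonneg (mul_nonneg hΔ.le (normSq_nonneg (R' r))) hω.le
    have t2 := mul_nonneg (normSq_nonneg (R r)) (hVpos r hr).le
    linarith
  · -- `G' r₀ < 0`
    refine ⟨r₀, hr₀, ?_⟩
    have hΔ : 0 < delta M a Λ r₀ := hΔpos r₀ hr₀
    show (conj ω * ((delta M a Λ r₀ : ℂ) * (R' r₀ * conj (R' r₀)) -
        masterRadialPotential M a Λ 0 μ ω m lamBar r₀ * (R r₀ * conj (R r₀)))).im < 0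
    rw [im_fluxDeriv_eq']
    have t1 := mul_nonneg (mul_nonneg hΔ.le (normSq_nonneg (R' r₀))) hω.le
    have t2 := mul_pos (Complex.normSq_pos.mpr hR₀) (hVpos r₀ hr₀)
    linarith
  · -- `G → 0` at the event horizon `r₊` (ingoing branch `(r − r₊)^{−B(r₊)}`)
    obtain ⟨ε, hε, f, hf, hRf⟩ := hin
    have hzre : 0 < (-horizonB M a Λ ω m (rPlus M a Λ)).re := by
      rw [neg_re, re_horizonB, neg_div, neg_neg]
      have hsq : 0 < rPlus M a Λ ^ 2 + a ^ 2 := add_pos_of_pos_of_nonneg (pow_pos hr₁ 2) (sq_nonneg a)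
      exact div_pos (mul_pos (mul_pos hξ hsq) hω) hd1
    have hb : rPlus M a Λ < min (rPlus M a Λ + ε) (rCosmo M a Λ) := lt_min (by linarith) h12
    have hJsub : Ioo (rPlus M a Λ) (min (rPlus M a Λ + ε) (rCosmo M a Λ)) ⊆
        Ioo (rPlus M a Λ - ε) (rPlus M a Λ + ε) := fun x hx =>
      ⟨by linarith [hx.1], lt_of_lt_of_le hx.2 (min_le_left _ _)⟩
    have hflux := tendsto_boundaryFlux_of_cpowBranch (x₀ := rPlus M a Λ)
      (U := Ioo (rPlus M a Λ - ε) (rPlus M a Λ + ε))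
      (J := Ioo (rPlus M a Λ) (min (rPlus M a Λ + ε) (rCosmo M a Λ))) isOpen_Ioo
      ⟨by linarith, by linarith⟩ isOpen_Ioo hJsub hf
      (u := fun x => x - rPlus M a Λ) (c := 1) (fun x => (hasDerivAt_id' x).sub_const _) (by simp)
      (fun x hx => by simp only [sub_pos]; exact hx.1) hzre (S := R) (S' := R')
      (fun x hx => (hode x ⟨hx.1, lt_of_lt_of_le hx.2 (min_le_right _ _)⟩).1)
      (fun x hx => by
        have hx0 : (0 : ℝ) < x - rPlus M a Λ := by linarith [hx.1]
        have hne : ((x - rPlus M a Λ : ℝ) : ℂ) ≠ 0 := by exact_mod_cast hx0.ne'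
        have h := hRf x ⟨hx.1, lt_of_lt_of_le hx.2 (min_le_left _ _)⟩
        simp only [ofReal_zero, zero_add] at h
        have hpow : ((x - rPlus M a Λ : ℝ) : ℂ) ^ horizonB M a Λ ω m (rPlus M a Λ) ≠ 0 := by
          rw [Ne, cpow_eq_zero_iff, not_and_or]; exact Or.inl hne
        rw [cpow_neg, ← h, mul_comm (R x) _, ← mul_assoc, inv_mul_cancel₀ hpow, one_mul])
    -- `Δ_r(x) = slope · (x − r₊)` with `slope → Δ_r'(r₊)`
    have hslope : Tendsto (slope (delta M a Λ) (rPlus M a Λ))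
        (𝓝[Ioo (rPlus M a Λ) (min (rPlus M a Λ + ε) (rCosmo M a Λ))] (rPlus M a Λ))
        (𝓝 (deltaDeriv M a Λ (rPlus M a Λ))) :=
      ((hasDerivAt_iff_tendsto_slope).1 (hasDerivAt_delta M a Λ (rPlus M a Λ))).mono_left
        (nhdsWithin_mono _ fun x hx => ne_of_gt hx.1)
    have hlim : Tendsto (fun x => (conj ω * (((slope (delta M a Λ) (rPlus M a Λ) x : ℝ) : ℂ) *
        (((x - rPlus M a Λ : ℝ) : ℂ) * R' x * conj (R x)))).im)
        (𝓝[Ioo (rPlus M a Λ) (min (rPlus M a Λ + ε) (rCosmo M a Λ))] (rPlus M a Λ)) (𝓝 0) := by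
      have := (hslope.ofReal.mul hflux).const_mul (conj ω)
      simpa only [mul_zero, Complex.zero_im, Function.comp_def] using
        (Complex.continuous_im.tendsto _).comp this
    rw [nhdsWithin_Ioo_eq_nhdsGT hb] at hlim
    refine hlim.congr' ?_
    filter_upwards [Ioo_mem_nhdsGT hb] with x hx
    have hx0 : x - rPlus M a Λ ≠ 0 := by linarith [hx.1]
    have hsl : slope (delta M a Λ) (rPlus M a Λ) x * (x - rPlus M a Λ) = delta M a Λ x := by
      rw [slope_def_field, hΔ1, sub_zero, div_mul_cancel₀ _ hx0]
    rw [← hsl]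
    congr 1
    push_cast
    ring
  · -- `G → 0` at the cosmological horizon `r_c` (outgoing branch `(r_c − r)^{+B(r_c)}`)
    obtain ⟨ε, hε, f, hf, hRf⟩ := hout
    have hzre : 0 < (horizonB M a Λ ω m (rCosmo M a Λ)).re := by
      rw [re_horizonB]
      have hsq : 0 < rCosmo M a Λ ^ 2 + a ^ 2 := add_pos_of_pos_of_nonneg (pow_pos hr₂ 2) (sq_nonneg a)
      have hnum : 0 < xi a Λ * (rCosmo M a Λ ^ 2 + a ^ 2) * ω.im := mul_pos (mul_pos hξ hsq) hω
      exact div_pos_of_neg_of_neg (by linarith) hd2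
    have hb : max (rCosmo M a Λ - ε) (rPlus M a Λ) < rCosmo M a Λ := max_lt (by linarith) h12
    have hJsub : Ioo (max (rCosmo M a Λ - ε) (rPlus M a Λ)) (rCosmo M a Λ) ⊆
        Ioo (rCosmo M a Λ - ε) (rCosmo M a Λ + ε) := fun x hx =>
      ⟨lt_of_le_of_lt (le_max_left _ _) hx.1, by linarith [hx.2]⟩
    have hflux := tendsto_boundaryFlux_of_cpowBranch (x₀ := rCosmo M a Λ)
      (U := Ioo (rCosmo M a Λ - ε) (rCosmo M a Λ + ε))
      (J := Ioo (max (rCosmo M a Λ - ε) (rPlus M a Λ)) (rCosmo M a Λ)) isOpen_Ioo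
      ⟨by linarith, by linarith⟩ isOpen_Ioo hJsub hf
      (u := fun x => rCosmo M a Λ - x) (c := -1) (fun x => (hasDerivAt_id' x).const_sub _)
      (by simp) (fun x hx => by simp only [sub_pos]; exact hx.2) hzre (S := R) (S' := R')
      (fun x hx => (hode x ⟨lt_of_le_of_lt (le_max_right _ _) hx.1, hx.2⟩).1)
      (fun x hx => by
        have hx0 : (0 : ℝ) < rCosmo M a Λ - x := by linarith [hx.2]
        have hne : ((rCosmo M a Λ - x : ℝ) : ℂ) ≠ 0 := by exact_mod_cast hx0.ne'
        have h := hRf x ⟨lt_of_le_of_lt (le_max_left _ _) hx.1, hx.2⟩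
        have hpow : ((rCosmo M a Λ - x : ℝ) : ℂ) ^ horizonB M a Λ ω m (rCosmo M a Λ) ≠ 0 := by
          rw [Ne, cpow_eq_zero_iff, not_and_or]; exact Or.inl hne
        rw [cpow_neg] at h
        rw [← h, mul_comm (R x) _, ← mul_assoc, mul_inv_cancel₀ hpow, one_mul])
    have hslope : Tendsto (slope (delta M a Λ) (rCosmo M a Λ))
        (𝓝[Ioo (max (rCosmo M a Λ - ε) (rPlus M a Λ)) (rCosmo M a Λ)] (rCosmo M a Λ))
        (𝓝 (deltaDeriv M a Λ (rCosmo M a Λ))) :=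
      ((hasDerivAt_iff_tendsto_slope).1 (hasDerivAt_delta M a Λ (rCosmo M a Λ))).mono_left
        (nhdsWithin_mono _ fun x hx => ne_of_lt hx.2)
    have hlim : Tendsto (fun x => (conj ω * (-((slope (delta M a Λ) (rCosmo M a Λ) x : ℝ) : ℂ) *
        (((rCosmo M a Λ - x : ℝ) : ℂ) * R' x * conj (R x)))).im)
        (𝓝[Ioo (max (rCosmo M a Λ - ε) (rPlus M a Λ)) (rCosmo M a Λ)] (rCosmo M a Λ)) (𝓝 0) := by
      have := (hslope.ofReal.neg.mul hflux).const_mul (conj ω)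
      simpa only [mul_zero, Complex.zero_im, Function.comp_def] using
        (Complex.continuous_im.tendsto _).comp this
    rw [nhdsWithin_Ioo_eq_nhdsLT hb] at hlim
    refine hlim.congr' ?_
    filter_upwards [Ioo_mem_nhdsLT hb] with x hx
    have hx0 : x - rCosmo M a Λ ≠ 0 := by linarith [hx.2]
    have hsl : slope (delta M a Λ) (rCosmo M a Λ) x * (x - rCosmo M a Λ) = delta M a Λ x := by
      rw [slope_def_field, hΔ2, sub_zero, div_mul_cancel₀ _ hx0]
    rw [← hsl]
    congr 1
    push_cast
    ring

/-- The weight `(r²+a²)² − a²Δ_r(r)` exceeds `(r₊²+a²)²` on `(r₊, r_c)` (it is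
`(r²+a²)r²Ξ + 2Ma²r`, increasing, and `Δ_r(r₊) = 0`). [cite: CasalsTeixeiradacosta2022, Theorem 3.10 (proof, Step 1)] -/
theorem sq_lt_weight {M a Λ : ℝ} (hsub : IsSubextremal M a Λ) {r : ℝ}
    (hr : r ∈ Ioo (rPlus M a Λ) (rCosmo M a Λ)) :
    (rPlus M a Λ ^ 2 + a ^ 2) ^ 2 < (r ^ 2 + a ^ 2) ^ 2 - a ^ 2 * delta M a Λ r := by
  obtain ⟨hM, hΛ, h01, -, hΔ1, -⟩ := hsub
  have hrm : 0 ≤ rMinus M a Λ := by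
    unfold rMinus
    exact Real.sInf_nonneg (fun x hx => le_of_lt hx.1)
  have hr₁ : 0 < rPlus M a Λ := lt_of_le_of_lt hrm h01
  have e1 := sq_sub_sq_mul_delta M a Λ (rPlus M a Λ)
  rw [hΔ1, mul_zero, sub_zero] at e1
  rw [e1, sq_sub_sq_mul_delta]
  exact weight_strictMono hM hΛ.le hr₁ hr.1

/-- **The superradiant window for growing scalar modes (Step 1 of Casals–Teixeira da Costa's
Theorem 3.10; `s = 0`, Klein–Gordon switch `μ ≥ 0`).** On subextremal Kerr–de Sitter with `a ≥ 0`, a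
NON-TRIVIAL solution of the `s = 0` radial master equation, ingoing at `𝓗⁺` and outgoing at `𝓗⁺_c`,
with `Im ω > 0` and separation constant satisfying `Im(λ̄ ω̄) ≤ 0`, has `m ≠ 0` and `|ω| < |m|·ϖ₊`,
`ϖ₊ = a/(r₊² + a²)` ("unless the superradiant condition `|ω|² < m²ϖ₁²` … holds … `u ≡ 0`").
[cite: CasalsTeixeiradacosta2022, Theorem 3.10 (proof, Step 1)] -/
theorem masterMode_zero_window {M a Λ μ : ℝ} {ω : ℂ} {m : ℝ} {lamBar : ℂ} {R : ℝ → ℂ}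
    (hsub : IsSubextremal M a Λ) (ha : 0 ≤ a) (hμ : 0 ≤ μ)
    (hω : 0 < ω.im) (hlam : (lamBar * conj ω).im ≤ 0)
    (hR : IsMasterRadialSolution M a Λ 0 μ ω m lamBar R)
    (hin : IsIngoingAtEventHorizon M a Λ 0 ω m R) (hout : IsOutgoingAtCosmoHorizon M a Λ ω m R)
    (hnt : ∃ r ∈ Ioo (rPlus M a Λ) (rCosmo M a Λ), R r ≠ 0) :
    m ≠ 0 ∧ ‖ω‖ < |m| * horizonAngVel a (rPlus M a Λ) := by
  -- Step 1 contraposed: somewhere on `(r₊, r_c)` the superradiant inequality holds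
  have key : ∃ r ∈ Ioo (rPlus M a Λ) (rCosmo M a Λ),
      ((r ^ 2 + a ^ 2) ^ 2 - a ^ 2 * delta M a Λ r) * normSq ω ≤ a ^ 2 * m ^ 2 := by
    by_contra h
    push Not at h
    obtain ⟨r, hr, hne⟩ := hnt
    exact hne (masterRadial_zero_eq_zero hsub hμ hω hlam h hR hin hout r hr)
  obtain ⟨r, hr, hle⟩ := key
  have hw := sq_lt_weight hsub hr
  obtain ⟨hM, hΛ, h01, -⟩ := hsub
  have hrm : 0 ≤ rMinus M a Λ := by
    unfold rMinus
    exact Real.sInf_nonneg (fun x hx => le_of_lt hx.1)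
  have hr₁ : 0 < rPlus M a Λ := lt_of_le_of_lt hrm h01
  have hsq1 : 0 < rPlus M a Λ ^ 2 + a ^ 2 := add_pos_of_pos_of_nonneg (pow_pos hr₁ 2) (sq_nonneg a)
  have hnorm : normSq ω = ‖ω‖ ^ 2 := Complex.normSq_eq_norm_sq ω
  have hωne : ω ≠ 0 := by
    rintro rfl
    simp at hω
  have hωpos : 0 < ‖ω‖ := norm_pos_iff.2 hωne
  have hwpos : 0 < (r ^ 2 + a ^ 2) ^ 2 - a ^ 2 * delta M a Λ r := lt_trans (pow_pos hsq1 2) hw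
  have hm : m ≠ 0 := by
    intro hm0
    rw [hm0] at hle
    have hpos : 0 < ((r ^ 2 + a ^ 2) ^ 2 - a ^ 2 * delta M a Λ r) * normSq ω :=
      mul_pos hwpos (by rw [hnorm]; positivity)
    nlinarith
  refine ⟨hm, ?_⟩
  have h1 : ‖ω‖ ^ 2 * (rPlus M a Λ ^ 2 + a ^ 2) ^ 2 < a ^ 2 * m ^ 2 := by
    have hω2 : 0 < ‖ω‖ ^ 2 := pow_pos hωpos 2
    calc ‖ω‖ ^ 2 * (rPlus M a Λ ^ 2 + a ^ 2) ^ 2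
        < ‖ω‖ ^ 2 * ((r ^ 2 + a ^ 2) ^ 2 - a ^ 2 * delta M a Λ r) :=
          mul_lt_mul_of_pos_left hw hω2
      _ = ((r ^ 2 + a ^ 2) ^ 2 - a ^ 2 * delta M a Λ r) * normSq ω := by rw [hnorm]; ring
      _ ≤ a ^ 2 * m ^ 2 := hle
  have h2 : ‖ω‖ * (rPlus M a Λ ^ 2 + a ^ 2) < |m| * a := by
    have hrhs : 0 ≤ |m| * a := mul_nonneg (abs_nonneg m) ha
    have h3 : (‖ω‖ * (rPlus M a Λ ^ 2 + a ^ 2)) ^ 2 < (|m| * a) ^ 2 := by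
      rw [mul_pow, mul_pow, sq_abs]
      linarith
    exact lt_of_pow_lt_pow_left₀ 2 hrhs h3
  rw [horizonAngVel, ← mul_div_assoc, lt_div_iff₀ hsq1]
  exact h2

/-- **Axisymmetric growing scalar modes do not exist** (`m = 0`, any `μ ≥ 0`): the printed
"mode stability for axially symmetric scalar perturbations holds true" ([Hintz2021KdSModes] §1.3),
here as the `m = 0` case of Step 1, given the angular sign `Im(λ̄ ω̄) ≤ 0`.
[cite: CasalsTeixeiradacosta2022, Theorem 3.10 (proof, Step 1)] -/
theorem masterRadial_zero_eq_zero_of_m_zero {M a Λ μ : ℝ} {ω : ℂ} {lamBar : ℂ} {R : ℝ → ℂ}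
    (hsub : IsSubextremal M a Λ) (hμ : 0 ≤ μ)
    (hω : 0 < ω.im) (hlam : (lamBar * conj ω).im ≤ 0)
    (hR : IsMasterRadialSolution M a Λ 0 μ ω 0 lamBar R)
    (hin : IsIngoingAtEventHorizon M a Λ 0 ω 0 R) (hout : IsOutgoingAtCosmoHorizon M a Λ ω 0 R) :
    ∀ r ∈ Ioo (rPlus M a Λ) (rCosmo M a Λ), R r = 0 := by
  refine masterRadial_zero_eq_zero hsub hμ hω hlam (fun r hr => ?_) hR hin hout
  have hw := sq_lt_weight hsub hr
  have hωne : ω ≠ 0 := by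
    rintro rfl
    simp at hω
  have hn : 0 < normSq ω := Complex.normSq_pos.2 hωne
  have hwpos : 0 < (r ^ 2 + a ^ 2) ^ 2 - a ^ 2 * delta M a Λ r :=
    lt_of_le_of_lt (sq_nonneg _) hw
  have := mul_pos hwpos hn
  simpa using this

/-! ### The conformal scalar (`μ = 1` = Teukolsky `s = 0`): hypothesis-free window, Lemma 3.1 being proved -/

/-- **Growing modes of the conformal scalar (Teukolsky `s = 0`) on subextremal Kerr–de Sitter are
superradiant: `m ≠ 0` and `|ω| < |m| ϖ₊`.** Step 1 of the proof of Theorem 3.10 combined with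
Lemma 3.1 (3.7) (the named fact `CasalsTeixeiraDaCosta2022_angularSign`, which is PROVED in
`KerrDeSitterPartialModeStability.lean`: pass `CasalsTeixeiraDaCosta2022_angularSign_holds` for `h2`)
for the Teukolsky modes of `KerrDeSitterTeukolskyRadial.lean` (`HasMode M a Λ 0 ω m`, `m ∈ ℤ`,
`a > 0`); no further hypothesis.
[cite: CasalsTeixeiradacosta2022, Theorem 3.10 (proof, Step 1)] -/
theorem hasMode_zero_window (h2 : CasalsTeixeiraDaCosta2022_angularSign) {M a Λ : ℝ} {ω : ℂ} {m : ℝ}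
    (hsub : IsSubextremal M a Λ) (ha : 0 < a)
    (hω : 0 < ω.im) (hm : ∃ k : ℤ, m = k) (hmode : HasMode M a Λ 0 ω m) :
    m ≠ 0 ∧ ‖ω‖ < |m| * horizonAngVel a (rPlus M a Λ) := by
  obtain ⟨lam, R, hang, hR, hin, hout, hnt⟩ := hmode
  have hs : ∃ k : ℤ, 2 * (0 : ℝ) = k := ⟨0, by simp⟩
  have hm' : ∃ k : ℤ, m - 0 = k := by simpa using hm
  have hlam : (lambdaBar a Λ 0 ω m lam * conj ω).im ≤ 0 :=
    (h2 a Λ 0 ω m lam hsub.2.1 ha hs hm' hω hang).le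
  have hR' : IsMasterRadialSolution M a Λ 0 1 ω m (lambdaBar a Λ 0 ω m lam) R :=
    (isMasterRadialSolution_one_iff M a Λ 0 ω m lam R).2 hR
  exact masterMode_zero_window hsub ha.le zero_le_one hω hlam hR' hin hout hnt

/-- The same statement as a `NoModeIn` window (the shape the venture's box statements consume):
for `s = 0` there is no Teukolsky mode with `Im ω > 0` and (`m = 0` or `|ω| ≥ |m| ϖ₊`).
[cite: CasalsTeixeiradacosta2022, Theorem 3.10 (proof, Step 1)] -/
theorem noModeIn_zero_superradiantComplement (h2 : CasalsTeixeiraDaCosta2022_angularSign)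
    {M a Λ : ℝ} (hsub : IsSubextremal M a Λ) (ha : 0 < a) :
    NoModeIn M a Λ 0
      {p | 0 < p.1.im ∧ (p.2 = 0 ∨ |p.2| * horizonAngVel a (rPlus M a Λ) ≤ ‖p.1‖)} := by
  intro ω m hW hm hmode
  obtain ⟨hω, hcase⟩ := hW
  have hm' : ∃ k : ℤ, m = k := by simpa using hm
  obtain ⟨hm0, hlt⟩ := hasMode_zero_window h2 hsub ha hω hm' hmode
  rcases hcase with h0 | hge
  · exact hm0 h0
  · exact absurd hlt (not_lt.2 hge)

/-- The master-system version for any `μ ≥ 0` (e.g. the massless wave equation, `μ = 0`), CONDITIONAL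
on the angular sign `Im(λ̄ ω̄) ≤ 0` for the `μ`-angular eigenvalues (the `μ`-analogue of Lemma 3.1,
supplied by the user): no `s = 0` master mode with `Im ω > 0` and (`m = 0` or `|ω| ≥ |m| ϖ₊`) — in
particular every growing massless-scalar mode has `m ≠ 0` and `|ω|² < m²ϖ₊²`.
[cite: CasalsTeixeiradacosta2022, Theorem 3.10 (proof, Step 1)] -/
theorem noMasterModeIn_zero_superradiantComplement {M a Λ μ : ℝ} (hsub : IsSubextremal M a Λ)
    (ha : 0 ≤ a) (hμ : 0 ≤ μ)
    (hsign : ∀ (ω : ℂ) (m : ℝ) (lamBar : ℂ), 0 < ω.im →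
      IsMasterAngularEigenvalue a Λ 0 μ ((a : ℂ) * ω) m lamBar → (lamBar * conj ω).im ≤ 0) :
    NoMasterModeIn M a Λ 0 μ
      {p | 0 < p.1.im ∧ (p.2 = 0 ∨ |p.2| * horizonAngVel a (rPlus M a Λ) ≤ ‖p.1‖)} := by
  intro ω m hW _hm hmode
  obtain ⟨hω, hcase⟩ := hW
  obtain ⟨lamBar, R, hang, hR, hin, hout, hnt⟩ := hmode
  obtain ⟨hm0, hlt⟩ := masterMode_zero_window hsub ha hμ hω (hsign ω m lamBar hω hang)
    hR hin hout hnt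
  rcases hcase with h0 | hge
  · exact hm0 h0
  · exact absurd hlt (not_lt.2 hge)

/-! ### Unconditional forms for the conformal scalar (Lemma 3.1 discharged by its proof) -/

/-- `hasMode_zero_window` with the angular sign discharged by the PROVED Lemma 3.1
(`CasalsTeixeiraDaCosta2022_angularSign_holds`): on any subextremal Kerr–de Sitter with `a > 0`,
every Teukolsky `s = 0` (conformal scalar) mode with `Im ω > 0` and `m ∈ ℤ` has `m ≠ 0` and
`|ω| < |m| ϖ₊` — no cited hypothesis left. [cite: CasalsTeixeiradacosta2022, Theorem 3.10 (proof, Step 1)] -/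
theorem hasMode_zero_window' {M a Λ : ℝ} {ω : ℂ} {m : ℝ} (hsub : IsSubextremal M a Λ)
    (ha : 0 < a) (hω : 0 < ω.im) (hm : ∃ k : ℤ, m = k) (hmode : HasMode M a Λ 0 ω m) :
    m ≠ 0 ∧ ‖ω‖ < |m| * horizonAngVel a (rPlus M a Λ) :=
  hasMode_zero_window CasalsTeixeiraDaCosta2022_angularSign_holds hsub ha hω hm hmode

/-- `noModeIn_zero_superradiantComplement` with Lemma 3.1 discharged: for `s = 0` there is no
Teukolsky mode with `Im ω > 0` and (`m = 0` or `|ω| ≥ |m| ϖ₊`), unconditionally.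
[cite: CasalsTeixeiradacosta2022, Theorem 3.10 (proof, Step 1)] -/
theorem noModeIn_zero_superradiantComplement' {M a Λ : ℝ} (hsub : IsSubextremal M a Λ)
    (ha : 0 < a) :
    NoModeIn M a Λ 0
      {p | 0 < p.1.im ∧ (p.2 = 0 ∨ |p.2| * horizonAngVel a (rPlus M a Λ) ≤ ‖p.1‖)} :=
  noModeIn_zero_superradiantComplement CasalsTeixeiraDaCosta2022_angularSign_holds hsub ha

/-! ### Unconditional forms for every `μ ≥ 0` (the `μ`-angular sign is `masterAngularEigenvalue_sign`) -/

/-- The `μ`-angular sign in the binder shape used above, from LIT-1's proved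
`masterAngularEigenvalue_sign` (Lemma 3.1 (3.7) for the master angular equation, any `μ ≥ 0`):
for `a > 0`, `Im ω > 0`, every master angular eigenvalue at `ν = aω` has `Im(λ̄ ω̄) ≤ 0`.
[cite: CasalsTeixeiradacosta2022, Lemma 3.1] -/
theorem masterAngularSign_lamBar_conj {a Λ s μ : ℝ} (hΛ : 0 ≤ Λ) (ha : 0 < a) (hμ : 0 ≤ μ)
    {ω : ℂ} {m : ℝ} {lamBar : ℂ} (hω : 0 < ω.im)
    (hang : IsMasterAngularEigenvalue a Λ s μ ((a : ℂ) * ω) m lamBar) :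
    (lamBar * conj ω).im ≤ 0 := by
  have hν : 0 < ((a : ℂ) * ω).im := by simpa [mul_im] using mul_pos ha hω
  have key := masterAngularEigenvalue_sign hΛ hμ hν hang
  have hid : (conj ((a : ℂ) * ω) * lamBar).im = a * (lamBar * conj ω).im := by
    simp only [map_mul, Complex.conj_ofReal, mul_im, mul_re, ofReal_re, ofReal_im, conj_re,
      conj_im]
    ring
  rw [hid] at key
  exact (neg_of_mul_neg_right key ha.le).le

/-- **Growing scalar modes on subextremal Kerr–de Sitter are superradiant — unconditionally, for every
Klein–Gordon switch `μ ≥ 0`** (massless `□_g` at `μ = 0`, conformal at `μ = 1`): a mode of the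
`s = 0` master system with `Im ω > 0` (rotation `a > 0`) has `m ≠ 0` and `|ω| < |m| ϖ₊`. Step 1 of
the proof of Theorem 3.10 + Lemma 3.1, both proved. [cite: CasalsTeixeiradacosta2022, Theorem 3.10 (proof, Step 1)] -/
theorem masterMode_zero_window' {M a Λ μ : ℝ} {ω : ℂ} {m : ℝ} {lamBar : ℂ} {R : ℝ → ℂ}
    (hsub : IsSubextremal M a Λ) (ha : 0 < a) (hμ : 0 ≤ μ) (hω : 0 < ω.im)
    (hmode : IsMasterModeSolution M a Λ 0 μ ω m lamBar R) :
    m ≠ 0 ∧ ‖ω‖ < |m| * horizonAngVel a (rPlus M a Λ) := by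
  obtain ⟨hang, hR, hin, hout, hnt⟩ := hmode
  exact masterMode_zero_window hsub ha.le hμ hω
    (masterAngularSign_lamBar_conj hsub.2.1.le ha hμ hω hang) hR hin hout hnt

/-- **No growing axisymmetric scalar modes** (`m = 0`, any `μ ≥ 0`, any subextremal Kerr–de Sitter with
`a > 0`), unconditionally: the printed "mode stability for axially symmetric scalar perturbations holds
true" ([Hintz2021KdSModes] §1.3), kernel-checked. [cite: CasalsTeixeiradacosta2022, Theorem 3.10 (proof, Step 1)] -/
theorem not_hasMasterMode_zero_of_m_zero {M a Λ μ : ℝ} {ω : ℂ} (hsub : IsSubextremal M a Λ)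
    (ha : 0 < a) (hμ : 0 ≤ μ) (hω : 0 < ω.im) : ¬HasMasterMode M a Λ 0 μ ω 0 := by
  rintro ⟨lamBar, R, hmode⟩
  exact (masterMode_zero_window' hsub ha hμ hω hmode).1 rfl

/-- The window form for every `μ ≥ 0`, unconditionally: no `s = 0` master mode with `Im ω > 0` and
(`m = 0` or `|ω| ≥ |m| ϖ₊`). For `μ = 0` this is the confinement the venture's massless-scalar boxes
(`NoMasterModeIn M a Λ 0 0 W`) need, with window radius `|m| ϖ₊` and nothing to certify at `m = 0`.
[cite: CasalsTeixeiradacosta2022, Theorem 3.10 (proof, Step 1)] -/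
theorem noMasterModeIn_zero_superradiantComplement' {M a Λ μ : ℝ} (hsub : IsSubextremal M a Λ)
    (ha : 0 < a) (hμ : 0 ≤ μ) :
    NoMasterModeIn M a Λ 0 μ
      {p | 0 < p.1.im ∧ (p.2 = 0 ∨ |p.2| * horizonAngVel a (rPlus M a Λ) ≤ ‖p.1‖)} :=
  noMasterModeIn_zero_superradiantComplement hsub ha.le hμ
    fun _ω _m _lamBar hω hang => masterAngularSign_lamBar_conj hsub.2.1.le ha hμ hω hang

end Literature.Geometry.Lorentzian.KerrDeSitter

end
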